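import Summits.FinalStateConjecture.FinalStateConjecture.Theorems.SwallowTheDatumParametricKerrBurialEngine
import Literature.Geometry.Lorentzian.InitialDataHomothety
import Literature.Geometry.Lorentzian.InitialDataDilation
import Literature.Geometry.Lorentzian.BilinPullbackEstimates
import Literature.Geometry.Manifold.OpenSubmanifoldMFDeriv
import Mathlib.Geometry.Euclidean.Inversion.Calculus
import HarnessLib

/-!
# Crux `SwallowTheDatum.UniversalWitnessFamily` (stmt-FinalStateConjecture-10051), line `Sketch`,
# stub `stub_capEnd` — support part 2: calculus of the sheet-2 inversion and the read data

Support file (everything proved, no definitions) for the stub `stub_capEnd` (capping the end through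
the inversion chart; engine interface `Theorems/SwallowTheDatumParametricKerrBurialEngine.lean`,
predicates `inv`, `invReadH`, `invReadK`, `VacAt`, `CapEndAt`).

* §1 the sheet-2 inversion `inv ρ₃ x = (ρ₃/‖x‖²) x`: it is Mathlib's `EuclideanGeometry.inversion`
  in the sphere of radius `√ρ₃` (`sInv_eq_inversion`), `‖inv ρ₃ x‖ = ρ₃/‖x‖`, an involution of
  `ℝ³ ∖ {0}` (`sInv_sInv`), smooth off the origin with CONFORMAL differential
  `D(inv ρ₃)_x = (ρ₃/‖x‖²)·(reflection in xᗮ)` (`fderiv_sInv`, Mathlib's `hasFDerivAt_inversion`;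
  `inner_fderiv_sInv`), and `D(inv ρ₃)_{inv x} ∘ D(inv ρ₃)_x = id` (chain rule);
* §2 **Kelvin's identity** `kelvin_identity`: with `X₃ ρ₃ = (M/2)²`,
  `X₃² (1 + M/(2X₃‖inv ρ₃ y‖))⁴ ⟪D v, D w⟫ = (1 + M/(2‖y‖))⁴ ⟪v, w⟫` — the inversion in the throat
  sphere is an isometry of isotropic Schwarzschild (Misner–Thorne–Wheeler 1973, §31.7);
* §3 the inversion chart `inv ρ₃ ∘ val` on the punctured slice `{0 < ‖x‖}` (smooth, injective
  differentials) and the READ DATUM `(c² inv^* h, c inv^* k)` of a datum on `ℝ³`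
  (`InitialDataSet.comap` followed by `InitialDataSet.homothety`): section formulas `read_h_inner`,
  `read_k`, and `read_vacAt` — it is vacuum at `u` when the datum is at `inv ρ₃ u`
  (`isVacuumAt_comap_iff`, `hamiltonianConstraintFn_homothety`, `momentumConstraintFn_homothety`;
  Bartnik–Isenberg 2004, §2);
* §4 the inverted readings `invReadH/invReadK` of the engine: unfolding, symmetry, positivity and
  smoothness off the origin (`bilinPullback`, `ContDiffOn.bilinPullback`).

References: C. W. Misner, K. S. Thorne, J. A. Wheeler, *Gravitation* (1973), §31.7; R. Bartnik,
J. Isenberg, *The constraint equations* (2004), §2; B. O'Neill, *Semi-Riemannian geometry* (1983),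
Ch. 3, Def. 3.9.
-/

-- the doubled `FinalStateConjecture` path component is the summit/problem naming scheme, not a mistake
set_option linter.dupNamespace false
-- instance problems on the nested operator type `E3 →L[ℝ] E3 →L[ℝ] ℝ` (`ContDiffOn.smul`) need one
-- more level of pending instance synthesis than the default
set_option maxSynthPendingDepth 2

noncomputable section

namespace Summit.FinalStateConjecture.FinalStateConjecture.Theorems.SwallowTheDatum.UniversalWitnessFamily

open scoped Manifold ContDiff Topology InnerProductSpace RealInnerProductSpace
open Set Filter Function TopologicalSpace Literature.Geometry.Lorentzian Literature.Geometry.Lorentzian.InitialDataSet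
open Literature.Geometry.Manifold (OpenSubmanifold.mfderiv_subtype_val OpenSubmanifold.mdifferentiableAt_subtype_val)
open Summit.FinalStateConjecture.FinalStateConjecture.Theorems.SwallowTheDatum.ParametricKerrBurial
  (VacAt inv invReadH invReadK)
open EuclideanGeometry (inversion)

/-! ### Calculus of the sheet-2 inversion `inv ρ₃ x = (ρ₃/‖x‖²) x` -/

section Inversion

variable {ρ₃ : ℝ}

/-- For `ρ₃ ≥ 0` the map `inv ρ₃` is Mathlib's inversion in the sphere of radius `√ρ₃` about the
origin. [folklore] -/
theorem sInv_eq_inversion (hρ : 0 ≤ ρ₃) : inv ρ₃ = inversion (0 : E3) (Real.sqrt ρ₃) := by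
  funext x
  simp only [inv, inversion, dist_zero_right, vsub_eq_sub, sub_zero, vadd_eq_add, add_zero, div_pow,
    Real.sq_sqrt hρ]

/-- `inv ρ₃ 0 = 0` (junk value at the origin). [folklore] -/
theorem sInv_zero (ρ₃ : ℝ) : inv ρ₃ 0 = 0 := by
  simp [inv]

/-- `‖inv ρ₃ x‖ = ρ₃ / ‖x‖` for `ρ₃ ≥ 0`. [folklore] -/
theorem norm_sInv (hρ : 0 ≤ ρ₃) (x : E3) : ‖inv ρ₃ x‖ = ρ₃ / ‖x‖ := by
  by_cases hx : x = 0
  · simp [hx, sInv_zero]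
  · have hn : ‖x‖ ≠ 0 := norm_ne_zero_iff.2 hx
    rw [inv, norm_smul, Real.norm_of_nonneg (div_nonneg hρ (sq_nonneg _))]
    field_simp

/-- `inv ρ₃ x ≠ 0` for `ρ₃ ≠ 0`, `x ≠ 0`. [folklore] -/
theorem sInv_ne_zero (hρ : ρ₃ ≠ 0) {x : E3} (hx : x ≠ 0) : inv ρ₃ x ≠ 0 := by
  have hn : ‖x‖ ≠ 0 := norm_ne_zero_iff.2 hx
  exact smul_ne_zero (div_ne_zero hρ (pow_ne_zero 2 hn)) hx

/-- **`inv ρ₃` is an involution** of `ℝ³ ∖ {0}` (and fixes the junk point `0`), `ρ₃ ≠ 0`. [folklore] -/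
theorem sInv_sInv (hρ : ρ₃ ≠ 0) (x : E3) : inv ρ₃ (inv ρ₃ x) = x := by
  by_cases hx : x = 0
  · rw [hx, sInv_zero, sInv_zero]
  · have hn : ‖x‖ ≠ 0 := norm_ne_zero_iff.2 hx
    rw [inv, inv, smul_smul, norm_smul, Real.norm_eq_abs, mul_pow, sq_abs]
    have h : ρ₃ / ((ρ₃ / ‖x‖ ^ 2) ^ 2 * ‖x‖ ^ 2) * (ρ₃ / ‖x‖ ^ 2) = 1 := by
      field_simp
    rw [h, one_smul]

/-- **Registered anchor of this support file** (`capEnd_sInv_sInv`, crux item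
stmt-FinalStateConjecture-10051): the sheet-2 inversion is an involution off the origin, `sInv_sInv`.
[folklore] -/
theorem capEnd_sInv_sInv : ∀ (ρ₃ : ℝ), ρ₃ ≠ 0 → ∀ x : E3, inv ρ₃ (inv ρ₃ x) = x :=
  fun _ hρ x ↦ sInv_sInv hρ x

/-- `inv ρ₃` is `C^n` off the origin. [folklore] -/
theorem contDiffAt_sInv (ρ₃ : ℝ) {x : E3} (hx : x ≠ 0) {n : WithTop ℕ∞} : ContDiffAt ℝ n (inv ρ₃) x := by
  have hn : ‖x‖ ^ 2 ≠ 0 := pow_ne_zero 2 (norm_ne_zero_iff.2 hx)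
  unfold inv
  exact (contDiffAt_const.div (contDiff_norm_sq ℝ).contDiffAt hn).smul contDiffAt_id

/-- `inv ρ₃` is differentiable off the origin. [folklore] -/
theorem differentiableAt_sInv (ρ₃ : ℝ) {x : E3} (hx : x ≠ 0) : DifferentiableAt ℝ (inv ρ₃) x :=
  (contDiffAt_sInv ρ₃ hx (n := 1)).differentiableAt one_ne_zero

/-- **The differential of the inversion**: `D(inv ρ₃)_x = (ρ₃/‖x‖²) · (reflection in xᗮ)` for
`x ≠ 0`, `ρ₃ ≥ 0` (Mathlib's `hasFDerivAt_inversion`). [folklore] -/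
theorem fderiv_sInv (hρ : 0 ≤ ρ₃) {x : E3} (hx : x ≠ 0) :
    fderiv ℝ (inv ρ₃) x = (ρ₃ / ‖x‖ ^ 2) • ((ℝ ∙ x)ᗮ.reflection : E3 →L[ℝ] E3) := by
  rw [sInv_eq_inversion hρ, (EuclideanGeometry.hasFDerivAt_inversion (c := (0 : E3))
    (R := Real.sqrt ρ₃) hx).fderiv, dist_zero_right, sub_zero, div_pow, Real.sq_sqrt hρ]

/-- The differential of the inversion, applied to a vector. [folklore] -/
theorem fderiv_sInv_apply (hρ : 0 ≤ ρ₃) {x : E3} (hx : x ≠ 0) (v : E3) :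
    fderiv ℝ (inv ρ₃) x v = (ρ₃ / ‖x‖ ^ 2) • (ℝ ∙ x)ᗮ.reflection v := by
  rw [fderiv_sInv hρ hx]
  rfl

/-- **The inversion is conformal**: `⟪D v, D w⟫ = (ρ₃/‖x‖²)² ⟪v, w⟫`, `D = D(inv ρ₃)_x`, `x ≠ 0`.
[folklore] -/
theorem inner_fderiv_sInv (hρ : 0 ≤ ρ₃) {x : E3} (hx : x ≠ 0) (v w : E3) :
    ⟪fderiv ℝ (inv ρ₃) x v, fderiv ℝ (inv ρ₃) x w⟫ = (ρ₃ / ‖x‖ ^ 2) ^ 2 * ⟪v, w⟫ := by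
  rw [fderiv_sInv_apply hρ hx, fderiv_sInv_apply hρ hx, real_inner_smul_left, real_inner_smul_right,
    LinearIsometryEquiv.inner_map_map]
  ring

/-- **Chain rule for the involution**: `D(inv ρ₃)_{inv ρ₃ x} ∘ D(inv ρ₃)_x = id` for `x ≠ 0`,
`ρ₃ ≠ 0`. [folklore] -/
theorem fderiv_sInv_comp (hρ : ρ₃ ≠ 0) {x : E3} (hx : x ≠ 0) :
    (fderiv ℝ (inv ρ₃) (inv ρ₃ x)).comp (fderiv ℝ (inv ρ₃) x) = ContinuousLinearMap.id ℝ E3 := by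
  have h : inv ρ₃ ∘ inv ρ₃ = id := funext fun y ↦ sInv_sInv hρ y
  rw [← fderiv_comp x (differentiableAt_sInv ρ₃ (sInv_ne_zero hρ hx)) (differentiableAt_sInv ρ₃ hx), h,
    fderiv_id]

/-- `D(inv ρ₃)_{inv ρ₃ x} (D(inv ρ₃)_x v) = v` for `x ≠ 0`, `ρ₃ ≠ 0`. [folklore] -/
theorem fderiv_sInv_apply_fderiv_sInv (hρ : ρ₃ ≠ 0) {x : E3} (hx : x ≠ 0) (v : E3) :
    fderiv ℝ (inv ρ₃) (inv ρ₃ x) (fderiv ℝ (inv ρ₃) x v) = v := by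
  have h := ContinuousLinearMap.ext_iff.1 (fderiv_sInv_comp hρ hx) v
  rwa [ContinuousLinearMap.comp_apply, ContinuousLinearMap.id_apply] at h

/-- The differential of the inversion at `x ≠ 0` is injective (`ρ₃ ≠ 0`). [folklore] -/
theorem injective_fderiv_sInv (hρ : ρ₃ ≠ 0) {x : E3} (hx : x ≠ 0) : Injective (fderiv ℝ (inv ρ₃) x) :=
  (LeftInverse.injective (g := fderiv ℝ (inv ρ₃) (inv ρ₃ x)) fun v ↦ fderiv_sInv_apply_fderiv_sInv hρ hx v)

/-- For `x ≠ 0`: `a < ‖inv ρ₃ x‖ ↔ a ‖x‖ < ρ₃`. [folklore] -/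
theorem lt_norm_sInv_iff (hρ : 0 ≤ ρ₃) {x : E3} (hx : x ≠ 0) (a : ℝ) : a < ‖inv ρ₃ x‖ ↔ a * ‖x‖ < ρ₃ := by
  rw [norm_sInv hρ, lt_div_iff₀ (norm_pos_iff.2 hx)]

/-- For `x ≠ 0`: `‖inv ρ₃ x‖ < a ↔ ρ₃ < a ‖x‖`. [folklore] -/
theorem norm_sInv_lt_iff (hρ : 0 ≤ ρ₃) {x : E3} (hx : x ≠ 0) (a : ℝ) : ‖inv ρ₃ x‖ < a ↔ ρ₃ < a * ‖x‖ := by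
  rw [norm_sInv hρ, div_lt_iff₀ (norm_pos_iff.2 hx)]

end Inversion

/-! ### The Kelvin identity -/

/-- **Kelvin's identity**: with `X₃ ρ₃ = (M/2)²`, un-reading the sheet-2 far field
`(1 + M/(2 X₃ ‖x‖))⁴ δ` through `x = inv ρ₃ y` at scale `X₃` gives the isotropic Schwarzschild(`M`)
metric: `X₃² (1 + M/(2X₃‖inv ρ₃ y‖))⁴ ⟪D v, D w⟫ = (1 + M/(2‖y‖))⁴ ⟪v, w⟫` (the inversion in the
throat sphere is an isometry of `(1 + M/2|y|)⁴ δ`; MTW 1973, §31.7). [folklore] -/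
theorem kelvin_identity {M ρ₃ X₃ : ℝ} (hρ : 0 < ρ₃) (hX : 0 < X₃) (hrel : X₃ * ρ₃ = (M / 2) ^ 2)
    {y : E3} (hy : y ≠ 0) (v w : E3) :
    X₃ ^ 2 * ((1 + M / (2 * X₃ * ‖inv ρ₃ y‖)) ^ 4 * ⟪fderiv ℝ (inv ρ₃) y v, fderiv ℝ (inv ρ₃) y w⟫) =
      Schwarzschild.conformalFactor M y ^ 4 * ⟪v, w⟫ := by
  rw [inner_fderiv_sInv hρ.le hy, norm_sInv hρ.le, Schwarzschild.conformalFactor_apply]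
  have hn : ‖y‖ ≠ 0 := norm_ne_zero_iff.2 hy
  have hX' : X₃ ≠ 0 := hX.ne'
  have hM : M ≠ 0 := by
    rintro rfl
    have h0 : X₃ * ρ₃ = 0 := by rw [hrel]; ring
    exact (mul_pos hX hρ).ne' h0
  have hρ' : ρ₃ = (M / 2) ^ 2 / X₃ := by
    rw [eq_div_iff hX', mul_comm]; exact hrel
  subst hρ'
  field_simp
  ring

/-! ### The inversion chart on the punctured slice -/

section Chart

variable {ρ₃ : ℝ}

/-- Points of the punctured slice are nonzero. [folklore] -/
theorem ne_zero_of_mem_puncturedSlice (u : Schwarzschild.puncturedSlice) : (u : E3) ≠ 0 :=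
  norm_pos_iff.1 u.2

/-- The inversion, read on the punctured slice `{0 < ‖x‖}`, is smooth. [folklore] -/
theorem contMDiff_invVal (ρ₃ : ℝ) :
    ContMDiff (𝓡 3) (𝓡 3) (∞ + 1) (inv ρ₃ ∘ (Subtype.val : Schwarzschild.puncturedSlice → E3)) := fun u ↦
  (contDiffAt_sInv ρ₃ (ne_zero_of_mem_puncturedSlice u)).contMDiffAt.comp u contMDiff_subtype_val.contMDiffAt

/-- The differential of the inversion read on the punctured slice is the Fréchet derivative of
`inv ρ₃`. [folklore] -/
theorem mfderiv_invVal (ρ₃ : ℝ) (u : Schwarzschild.puncturedSlice) :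
    mfderiv (𝓡 3) (𝓡 3) (inv ρ₃ ∘ (Subtype.val : Schwarzschild.puncturedSlice → E3)) u =
      fderiv ℝ (inv ρ₃) (u : E3) := by
  have hg : MDifferentiableAt 𝓘(ℝ, E3) (𝓡 3) (inv ρ₃) ((Subtype.val : Schwarzschild.puncturedSlice → E3) u) :=
    ((contDiffAt_sInv ρ₃ (ne_zero_of_mem_puncturedSlice u) (n := ∞)).contMDiffAt).mdifferentiableAt (by simp)
  rw [mfderiv_comp u hg (OpenSubmanifold.mdifferentiableAt_subtype_val u), OpenSubmanifold.mfderiv_subtype_val]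
  exact (ContinuousLinearMap.comp_id _).trans mfderiv_eq_fderiv

/-- The differentials of the inversion chart are injective (`ρ₃ ≠ 0`). [folklore] -/
theorem injective_mfderiv_invVal (hρ : ρ₃ ≠ 0) (u : Schwarzschild.puncturedSlice) :
    Injective (mfderiv (𝓡 3) (𝓡 3) (inv ρ₃ ∘ (Subtype.val : Schwarzschild.puncturedSlice → E3)) u) := by
  rw [mfderiv_invVal]
  exact injective_fderiv_sInv hρ (ne_zero_of_mem_puncturedSlice u)

/-- **The READ datum** of `D` through the inversion at scale `c`: the metric of
`(inv^* D)` rescaled by `c²`, at `u`, is `c² h_D(inv u)(D v, D w)`. [folklore] -/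
theorem read_h_inner (D : InitialDataSet (𝓡 3) E3) (hρ : ρ₃ ≠ 0) {c : ℝ} (hc : 0 < c)
    (u : Schwarzschild.puncturedSlice) (v w : E3) :
    ((D.comap (inv ρ₃ ∘ Subtype.val) (contMDiff_invVal ρ₃) (injective_mfderiv_invVal hρ)).homothety c hc).h.inner
        u v w =
      c ^ 2 * D.h.inner (inv ρ₃ (u : E3)) (fderiv ℝ (inv ρ₃) (u : E3) v) (fderiv ℝ (inv ρ₃) (u : E3) w) := by
  rw [homothety_h_inner, comap_h_inner, mfderiv_invVal]
  rfl

/-- The tensor `k` of the read datum at `u` is `c k_D(inv u)(D v, D w)`. [folklore] -/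
theorem read_k (D : InitialDataSet (𝓡 3) E3) (hρ : ρ₃ ≠ 0) {c : ℝ} (hc : 0 < c)
    (u : Schwarzschild.puncturedSlice) (v w : E3) :
    ((D.comap (inv ρ₃ ∘ Subtype.val) (contMDiff_invVal ρ₃) (injective_mfderiv_invVal hρ)).homothety c hc).k
        u v w =
      c * D.k (inv ρ₃ (u : E3)) (fderiv ℝ (inv ρ₃) (u : E3) v) (fderiv ℝ (inv ρ₃) (u : E3) w) := by
  rw [homothety_k, comap_k, mfderiv_invVal]
  rfl

/-- **The read datum is vacuum at `u` when `D` is at `inv ρ₃ u`** (pull-back along a local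
diffeomorphism, `isVacuumAt_comap_iff`, followed by the constant rescaling `(h, k) ↦ (c² h, c k)`,
`hamiltonianConstraintFn_homothety`, `momentumConstraintFn_homothety`). Bartnik–Isenberg 2004, §2.
[cite: BartnikIsenberg2004, §2] -/
theorem read_vacAt (D : InitialDataSet (𝓡 3) E3) (hρ : ρ₃ ≠ 0) {c : ℝ} (hc : 0 < c)
    (u : Schwarzschild.puncturedSlice) (hD : VacAt D (inv ρ₃ (u : E3))) :
    ∀ [((D.comap (inv ρ₃ ∘ Subtype.val) (contMDiff_invVal ρ₃) (injective_mfderiv_invVal hρ)).homothety c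
        hc).metric.HasLeviCivita],
      ((D.comap (inv ρ₃ ∘ Subtype.val) (contMDiff_invVal ρ₃) (injective_mfderiv_invVal hρ)).homothety c
          hc).hamiltonianConstraintFn u = 0 ∧
        ((D.comap (inv ρ₃ ∘ Subtype.val) (contMDiff_invVal ρ₃) (injective_mfderiv_invVal hρ)).homothety c
          hc).momentumConstraintFn u = 0 := by
  intro _
  haveI : D.metric.HasLeviCivita := PseudoRiemannianMetric.hasLeviCivita _
  haveI : (D.comap (inv ρ₃ ∘ Subtype.val) (contMDiff_invVal ρ₃) (injective_mfderiv_invVal hρ)).metric.HasLeviCivita :=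
    PseudoRiemannianMetric.hasLeviCivita _
  have h1 := (isVacuumAt_comap_iff D (contMDiff_invVal ρ₃) (injective_mfderiv_invVal hρ) u).2 hD
  refine ⟨?_, ?_⟩
  · rw [hamiltonianConstraintFn_homothety, h1.1, mul_zero]
  · rw [momentumConstraintFn_homothety, h1.2, smul_zero]

end Chart

/-! ### The inverted readings -/

section Readings

variable (G : InitialDataSet (𝓡 3) E3) (ρ₃ X₃ : ℝ)

/-- `invReadH G ρ₃ X₃ x (v, w) = X₃⁻² h_G(inv x)(D v, D w)`. [folklore] -/
theorem invReadH_apply (x v w : E3) :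
    invReadH G ρ₃ X₃ x v w =
      (X₃ ^ 2)⁻¹ * G.coordH (inv ρ₃ x) (fderiv ℝ (inv ρ₃) x v) (fderiv ℝ (inv ρ₃) x w) := rfl

/-- `invReadK G ρ₃ X₃ x (v, w) = X₃⁻¹ k_G(inv x)(D v, D w)`. [folklore] -/
theorem invReadK_apply (x v w : E3) :
    invReadK G ρ₃ X₃ x v w = X₃⁻¹ * G.coordK (inv ρ₃ x) (fderiv ℝ (inv ρ₃) x v) (fderiv ℝ (inv ρ₃) x w) := rfl

/-- The inverted metric reading is a constant multiple of the coordinate pull-back `bilinPullback`.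
[folklore] -/
theorem invReadH_eq_bilinPullback :
    invReadH G ρ₃ X₃ = fun x ↦ (X₃ ^ 2)⁻¹ • bilinPullback (inv ρ₃) G.coordH x := by
  funext x
  ext v w
  rfl

/-- The inverted reading of `k` is a constant multiple of the coordinate pull-back. [folklore] -/
theorem invReadK_eq_bilinPullback :
    invReadK G ρ₃ X₃ = fun x ↦ X₃⁻¹ • bilinPullback (inv ρ₃) G.coordK x := by
  funext x
  ext v w
  rfl

/-- The coordinate reading `coordH` of a datum on `ℝ³` is a smooth map. [folklore] -/
theorem contDiff_coordH (D : InitialDataSet (𝓡 3) E3) : ContDiff ℝ ∞ D.coordH :=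
  contMDiff_iff_contDiff.1 D.contMDiff_coordH

/-- The coordinate reading `coordK` of a datum on `ℝ³` is a smooth map. [folklore] -/
theorem contDiff_coordK (D : InitialDataSet (𝓡 3) E3) : ContDiff ℝ ∞ D.coordK :=
  contMDiff_iff_contDiff.1 D.contMDiff_coordK

/-- The coordinate pull-back of a smooth field along `inv ρ₃` is smooth off the origin. [folklore] -/
theorem contDiffOn_bilinPullback_sInv {B : E3 → E3 →L[ℝ] E3 →L[ℝ] ℝ} (hB : ContDiff ℝ ∞ B) :
    ContDiffOn ℝ ∞ (bilinPullback (inv ρ₃) B) {x : E3 | x ≠ 0} :=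
  ContDiffOn.bilinPullback (n := (⊤ : ℕ∞)) (t := univ)
    (fun _ hx ↦ (contDiffAt_sInv ρ₃ hx).contDiffWithinAt) hB.contDiffOn isOpen_ne (mapsTo_univ _ _)

/-- **The inverted metric reading is smooth off the origin.** [folklore] -/
theorem contDiffOn_invReadH : ContDiffOn ℝ ∞ (invReadH G ρ₃ X₃) {x : E3 | x ≠ 0} := by
  rw [invReadH_eq_bilinPullback]
  exact (contDiffOn_const (c := (X₃ ^ 2)⁻¹)).smul (contDiffOn_bilinPullback_sInv ρ₃ (contDiff_coordH G))

/-- **The inverted reading of `k` is smooth off the origin.** [folklore] -/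
theorem contDiffOn_invReadK : ContDiffOn ℝ ∞ (invReadK G ρ₃ X₃) {x : E3 | x ≠ 0} := by
  rw [invReadK_eq_bilinPullback]
  exact (contDiffOn_const (c := X₃⁻¹)).smul (contDiffOn_bilinPullback_sInv ρ₃ (contDiff_coordK G))

/-- The inverted metric reading is symmetric. [folklore] -/
theorem invReadH_symm (x v w : E3) : invReadH G ρ₃ X₃ x v w = invReadH G ρ₃ X₃ x w v := by
  rw [invReadH_apply, invReadH_apply, coordH_apply, coordH_apply, G.h.symm]

/-- The inverted reading of `k` is symmetric. [folklore] -/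
theorem invReadK_symm (x v w : E3) : invReadK G ρ₃ X₃ x v w = invReadK G ρ₃ X₃ x w v := by
  rw [invReadK_apply, invReadK_apply, coordK_apply, coordK_apply, G.k_symm]

variable {ρ₃ X₃}

/-- The inverted metric reading is positive definite off the origin (`D(inv ρ₃)_x` is injective).
[folklore] -/
theorem invReadH_pos (hρ : ρ₃ ≠ 0) (hX : 0 < X₃) {x : E3} (hx : x ≠ 0) {v : E3} (hv : v ≠ 0) :
    0 < invReadH G ρ₃ X₃ x v v := by
  rw [invReadH_apply, coordH_apply]
  refine mul_pos (inv_pos.2 (pow_pos hX 2)) (G.h.pos _ _ fun h0 ↦ hv ?_)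
  apply injective_fderiv_sInv hρ hx
  rw [map_zero]
  exact h0

end Readings


end Summit.FinalStateConjecture.FinalStateConjecture.Theorems.SwallowTheDatum.UniversalWitnessFamily

end
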